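import Summits.ABC.IUTFork.Charitable.Thm311D4
import HarnessLib

/-!
# [IUTchIII] Theorem 3.11, team D4's charitable re-typing — bookkeeping CHECKS on `Thm311Charitable_4`

Proof-only companion (D-0012; abc-iut cell, block D team D4, seat abc-iut-D4-typ) of `Charitable/Thm311D4.lean` (p433089, DEFS-FROZEN).
TAKES NO SIDE on [IUTchIII] Cor. 3.12; no definition, no `Prop` fact. Two kernel facts the typing's docstrings assert in words:

* `nfLinkCompat_of_multiradialCompat_kummerC` — the (iii) (d) clause `D4.NFLinkCompat` FOLLOWS from (i) `MultiradialCompat` and (ii) (c)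
  `KummerC` in the bi-coric strictification (so it carries no charity and no weight);
* `linkKummerCompat_iff_mem_possibleImages` — under (i) `MultiradialCompat` and (ii) (b) `KummerB`, the decisive charitable clause
  `D4.LinkKummerCompat` says EXACTLY: «at every `(n, m)` the Kummer image of the q-pilot splitting monoid IS the splitting monoid of a
  possible image `D′ ∈ ^{n,∘}ℜ^LGP` of the line-`n` data» — i.e. it is, at datum level, the sentence of Cor. 3.12 Step (xi-c)/(xi-d)/(xi-e)
  (p. 182 l. 27–31, p. 183 l. 4–7, p. 183 l. 43 – p. 184 l. 18: the output possibilities are «linked/related [cf. (IPL)] … to the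
  representation [via the log-Kummer correspondence in the 1-column] of the q-pilot object») read as membership — no more, no less. This is
  the sentence the D referees grade FAITHFUL / STRONGER-THAN-PRINT; the equivalence lets them grade ONE sentence whichever phrasing they
  prefer. [claim: Mochizuki2012, status: disputed]
-/

namespace Summit.ABC.IUTFork.Charitable.D4

open Thm311

variable {T : ThetaIndex} {S : LatticeSituation T} {Q : LinkKummerData S}

/-- (iii) (d)'s clause `NFLinkCompat` follows from (i) `MultiradialCompat` ∧ (ii) (c) `KummerC`: the line-`n` data is a possible image
`(S.D (n−1)).map Φ` of the line-`(n−1)` data, and both columns' number-field Kummer images land on their lines' coric number fields.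
[claim: Mochizuki2012, status: disputed] -/
theorem nfLinkCompat_of_multiradialCompat_kummerC (hMR : S.MultiradialCompat) (hC : ∀ n : ℤ, (S.col n).KummerC (S.D n)) :
    NFLinkCompat S := by
  intro n m
  have hmem : S.D n ∈ (S.D (n - 1)).RLGP := S.mem_RLGP_of_multiradialCompat hMR (n - 1) n
  obtain ⟨Φ, hΦ, hmap⟩ := (MRData.mem_RLGP_iff _ _).1 hmem
  refine ⟨Φ, hΦ, 0, fun j => ?_⟩
  rw [hC n m j, hC (n - 1) 0 j, hmap]
  rfl

/-- Hence `NFLinkCompat` holds under the frozen (i) ∧ (ii) — in particular under `Thm311Literal_4`'s first two conjuncts and under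
`Thm311Charitable_4`. [claim: Mochizuki2012, status: disputed] -/
theorem nfLinkCompat_of_partI_partII (h1 : S.PartI) (h2 : S.PartII) : NFLinkCompat S :=
  nfLinkCompat_of_multiradialCompat_kummerC h1.2.2 fun n => (h2 n).2.2.1

/-- **What the decisive clause says.** Under (i) `MultiradialCompat` and (ii) (b) `KummerB` (every column): `LinkKummerCompat S Q` ⟺ at
every `(n, m)` the q-pilot's Kummer image `Q.qΨ n m` is the splitting monoid `D′.Ψ` of SOME possible image `D′ ∈ ^{n,∘}ℜ^LGP` of the line-`n`
data — the datum-level form of «the representation … of the q-pilot object» being among «the collection of possibilities of output data»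
(Cor. 3.12 Step (xi-c)–(xi-e), p. 182 l. 27–31, p. 183 l. 4–7). [claim: Mochizuki2012, status: disputed] -/
theorem linkKummerCompat_iff_mem_possibleImages (hMR : S.MultiradialCompat) (hB : ∀ n : ℤ, (S.col n).KummerB (S.D n)) :
    LinkKummerCompat S Q ↔ ∀ n m : ℤ, ∃ D' ∈ S.RLGP n, Q.qΨ n m = D'.Ψ := by
  constructor
  · intro h n m
    obtain ⟨Φ, hΦ, m', hm'⟩ := h n m
    refine ⟨(S.D (n - 1)).map Φ, ?_, funext fun v => funext fun hv => ?_⟩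
    · rw [hMR n (n - 1)]
      exact MRData.map_mem_RLGP _ hΦ
    · rw [hm' v hv, hB (n - 1) m' v hv]
      rfl
  · intro h n m
    obtain ⟨D', hD', hq⟩ := h n m
    have hmem : D' ∈ (S.D (n - 1)).RLGP := by rw [hMR n (n - 1)] at hD'; exact hD'
    obtain ⟨Φ, hΦ, rfl⟩ := (MRData.mem_RLGP_iff _ _).1 hmem
    refine ⟨Φ, hΦ, 0, fun v hv => ?_⟩
    rw [hq, hB (n - 1) 0 v hv]
    rfl

/-- The same under the whole charitable reading: `Thm311Charitable_4 S Q` gives, at every `(n, m)`, a possible image `D′ ∈ ^{n,∘}ℜ^LGP` with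
`Q.qΨ n m = D′.Ψ` (the shape team D4's deriver feeds to the pins with `qK := Q.qΨ P.n m`). [claim: Mochizuki2012, status: disputed] -/
theorem exists_mem_RLGP_qΨ_eq_of_charitable (h : Thm311Charitable_4 S Q) (n m : ℤ) : ∃ D' ∈ S.RLGP n, Q.qΨ n m = D'.Ψ :=
  (linkKummerCompat_iff_mem_possibleImages h.1.2.2 (fun k => (h.2.1 k).2.1)).1 h.2.2.2.2 n m

end Summit.ABC.IUTFork.Charitable.D4
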